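import Summits.Ventures.Crystal3D.Theorems.StickyWulffConstantTextureBuildRiserClaim
import Summits.Ventures.Crystal3D.Theorems.StickyWulffConstantTextureLiminfTexShadowBilayerFrameRigidity
import HarnessLib

/-!
# The RISER PACKAGE (B6), part 8: SHARED SLABS ARE FREE (LEMMA SH)
# (lane T, crux `TextureLiminfV5`, stmt-Ventures-23912; design memo HOME/wulff-p2/g21/B6-DESIGN-g21.md §2 (BX, «no-riser slab»); target `RiserPackage₇`)

HONEST FRAMING. Venture `Summits/Ventures/Crystal3D` (cell `crystal3d-full`), route `route-Ventures-StickyWulffConstant`, helper `--supports` the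
law-v5 crux `TextureLiminfV5` (stmt-Ventures-23912).  Standard axioms; no mesh constructed; F-C1 not moved.

WHY.  Inside a riser box the default grain is `g = rtR r` everywhere outside the hexagon prisms of occupied riser `f`-sites; in a slab of the riser frame
whose two boundary layers are SHARED (the `σL`- and `σR`-layers coincide as point sets) a `g`-labelled cell may touch `f`-material.  Such contacts are FREE:

* `TentPiece.frame_image_eq_of_presentation` — a tent piece whose stacking has a second presentation `(L', s', σ')` («two layerings», '…RiserAxis'):
  the canonical frame of its slab `a` has the lattice of `canFrame (bilayer L' s' σ' m)` whenever slab `a` and the `L'`-slab `m` share a point (parallel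
  axes: slab dictionary of '…FrameAgreement', the two bilayers COINCIDE; one fcc lattice: bilayer rigidity);
* `Mesh₅.bilayer_eq_of_shared` — shared layers `m, m+1` ⇒ the `σL`- and `σR`-bilayers `m` of the riser frame coincide;
* **`TexInput.lattice_eq_of_shared_slab`** (LEMMA SH) — two pieces with grains among the two column grains, each with a point in the open riser slab `m₀`
  whose boundary layers are shared, have EQUAL class lattices (`lawC = 0`);
* `TexInput.exists_mem_rslab` — at a generic boundary point with non-horizontal datum the piece has points in the open riser slab `⌊rheight y/hB⌋`;
  `lattice_eq_of_shared_contact` — LEMMA SH at a generic contact.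
-/

noncomputable section

open scoped BigOperators InnerProductSpace

namespace Summit.Ventures.Crystal3D.Cruxes.TextureLiminf.TexShadow

open Summit.Ventures.Crystal3D Summit.Ventures.Crystal3D.Theorems Set
open Summit.Ventures.Crystal3D.TentCertificate (hB hB_sq hB_pos mem_laySlab_iff bilayer_eq_image bilayer_subset_stacking image_fccRef_eq_of_bilayer_subset)
open Literature.MathematicalPhysics.StatisticalMechanics (IsHaggSeq barlowPos barlowPos_mem)

/-! ### One piece, two presentations -/

namespace TentPiece

/-- **Two presentations, one slab lattice.**  If the stacking of `T` is also `stacking L' s' σ'` and the own slab `a` meets the `L'`-slab `m`, the canonical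
frame of slab `a` has the lattice of `canFrame (bilayer L' s' σ' m)`. -/
theorem frame_image_eq_of_presentation (T : TentPiece) {L' : E3 ≃ₗᵢ[ℝ] E3} {s' : E3} {σ' : ℤ → ℤ} (hσ' : IsHaggSeq σ')
    (hS : stacking T.L T.s T.σ = stacking L' s' σ') {a m : ℤ} {w : E3} (hwa : w ∈ laySlab T.L T.s a) (hwm : w ∈ laySlab L' s' m) :
    T.frame a '' fccRef = canFrame (bilayer L' s' σ' m) '' fccRef := by
  rcases axis_parallel_or_affineFcc T.hσ hσ' hS with hpar | ⟨A, hA⟩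
  · -- PARALLEL AXES: the slab dictionary identifies slab `a` with slab `m`, the two bilayers coincide
    have hx₀' : L' (barlowPos 1 hB σ' 0 0 0) + s' ∈ stacking L' s' σ' := ⟨_, barlowPos_mem _ _ _, rfl⟩
    have hx₀ : L' (barlowPos 1 hB σ' 0 0 0) + s' ∈ stacking T.L T.s T.σ := by rw [hS]; exact hx₀'
    obtain ⟨ε, d, hε, hdict⟩ := exists_height_dictionary hpar hx₀ hx₀'
    obtain ⟨a', hslab, hbdry⟩ := laySlab_eq_of_dictionary hε hdict m
    have haa : a' = a := by
      rw [hslab] at hwm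
      rw [mem_laySlab_iff] at hwa hwm
      have hh := hB_pos
      have h1 : (a : ℝ) < a' + 1 := lt_of_mul_lt_mul_right (lt_of_le_of_lt hwa.1.le hwm.2) hh.le
      have h2 : (a' : ℝ) < a + 1 := lt_of_mul_lt_mul_right (lt_of_le_of_lt hwm.1.le hwa.2) hh.le
      have h1' : a < a' + 1 := by exact_mod_cast h1
      have h2' : a' < a + 1 := by exact_mod_cast h2
      omega
    subst haa
    have hbil : bilayer T.L T.s T.σ a' = bilayer L' s' σ' m := by
      ext v
      rw [mem_bilayer_iff_height, mem_bilayer_iff_height, hS, hbdry v]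
    unfold TentPiece.frame
    rw [hbil]
  · -- ONE AFFINE fcc LATTICE: both frames carry its linear lattice
    have hT : T.frame a '' fccRef = A '' fccRef := bilayerFrame_image_eq T.hσ hA T.framesAt a
    obtain ⟨u, hu⟩ := canFrame_spec hσ' L' s' m
    have hc : canFrame (bilayer L' s' σ' m) '' fccRef = A '' fccRef := by
      refine image_fccRef_eq_of_bilayer_subset hσ' L' s' m hu (u' := T.s) fun v hv => ?_
      have hv' : v ∈ stacking L' s' σ' := bilayer_subset_stacking _ _ _ _ hv
      rw [← hS, hA] at hv'
      exact hv'
    rw [hT, hc]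

end TentPiece

/-! ### Shared layers: one bilayer -/

namespace Mesh₅

variable {C R₀ : ℝ} {N : ℕ} {x : Fin N → E3} {rc : RiseredCover C R₀ N x} {δ : ℝ} (μ : Mesh₅ rc δ)

/-- **Shared layers `m, m+1` ⇒ the `σL`- and `σR`-bilayers `m` of the riser frame coincide.** -/
theorem bilayer_eq_of_shared {r : Fin rc.nr} {m : ℤ} (hs0 : μ.IsSharedLayer r m) (hs1 : μ.IsSharedLayer r (m + 1)) :
    bilayer (μ.rL r) (μ.rs r) (μ.rσL r) m = bilayer (μ.rL r) (μ.rs r) (μ.rσR r) m := by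
  unfold IsSharedLayer at hs0 hs1
  rw [bilayer_eq_image, bilayer_eq_image, hs0, hs1]

/-- Riser height and membership in a riser slab. -/
theorem mem_rlaySlab_iff (r : Fin rc.nr) (m : ℤ) (w : E3) :
    w ∈ laySlab (μ.rL r) (μ.rs r) m ↔ (m : ℝ) * hB < μ.rheight r w ∧ μ.rheight r w < ((m : ℝ) + 1) * hB :=
  mem_laySlab_iff _ _ _ _

end Mesh₅

/-! ### LEMMA SH -/

namespace TexInput

variable {C R₀ : ℝ} {N : ℕ} {x : Fin N → E3} {rc : RiseredCover C R₀ N x} {δ : ℝ} {μ : Mesh₅ rc δ} (I : TexInput rc μ)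

/-- **A piece of a column grain meeting the open riser slab `m₀` has the lattice of the riser frame's `σL`-bilayer `m₀`** — when the boundary layers
`m₀, m₀ + 1` are shared (for `g` the `σR`-bilayer is the `σL`-bilayer). -/
theorem frame_image_eq_rbilayer (r : Fin rc.nr) {j : Fin I.cells.M} (hg : I.grain j = rc.rtL r ∨ I.grain j = rc.rtR r) {m₀ : ℤ}
    (hs0 : μ.IsSharedLayer r m₀) (hs1 : μ.IsSharedLayer r (m₀ + 1)) {v : E3} (hv : v ∈ polytope (I.cells.Hp j))
    (hvm : (m₀ : ℝ) * hB < μ.rheight r v ∧ μ.rheight r v < ((m₀ : ℝ) + 1) * hB) :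
    (rc.tent (I.grain j)).frame (I.slab j) '' fccRef = canFrame (bilayer (μ.rL r) (μ.rs r) (μ.rσL r) m₀) '' fccRef := by
  obtain ⟨hσL, hσR, hf, hg', -⟩ := μ.rframe_spec r
  have hvslab := I.subset_laySlab j hv
  have hvm' : v ∈ laySlab (μ.rL r) (μ.rs r) m₀ := (μ.mem_rlaySlab_iff r m₀ v).2 hvm
  rcases hg with hg | hg
  · rw [hg] at hvslab ⊢
    exact (rc.tent (rc.rtL r)).frame_image_eq_of_presentation hσL hf hvslab hvm'
  · rw [hg] at hvslab ⊢
    rw [(rc.tent (rc.rtR r)).frame_image_eq_of_presentation hσR hg' hvslab hvm', μ.bilayer_eq_of_shared hs0 hs1]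

/-- **LEMMA SH**: two pieces with column grains, each with a point in the open riser slab `m₀` whose boundary layers are SHARED, have equal class lattices. -/
theorem lattice_eq_of_shared_slab (r : Fin rc.nr) {i i' : Fin I.cells.M} (hgi : I.grain i = rc.rtL r ∨ I.grain i = rc.rtR r)
    (hgi' : I.grain i' = rc.rtL r ∨ I.grain i' = rc.rtR r) {m₀ : ℤ} (hs0 : μ.IsSharedLayer r m₀) (hs1 : μ.IsSharedLayer r (m₀ + 1))
    {w : E3} (hw : w ∈ polytope (I.cells.Hp i)) (hwm : (m₀ : ℝ) * hB < μ.rheight r w ∧ μ.rheight r w < ((m₀ : ℝ) + 1) * hB)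
    {w' : E3} (hw' : w' ∈ polytope (I.cells.Hp i')) (hw'm : (m₀ : ℝ) * hB < μ.rheight r w' ∧ μ.rheight r w' < ((m₀ : ℝ) + 1) * hB) :
    (rc.tent (I.grain i)).frame (I.slab i) '' fccRef = (rc.tent (I.grain i')).frame (I.slab i') '' fccRef :=
  (I.frame_image_eq_rbilayer r hgi hs0 hs1 hw hwm).trans (I.frame_image_eq_rbilayer r hgi' hs0 hs1 hw' hw'm).symm

/-! ### Points of a piece in the riser slab at a generic boundary point -/

/-- **At a generic boundary point with non-upward datum (`p.1 ≠ rn r`) the piece has points in the open riser slab `⌊rheight y / hB⌋`.** -/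
theorem exists_mem_rslab (r : Fin rc.nr) {i : Fin I.cells.M} {p : E3 × ℝ} (hp : p ∈ I.cells.Hp i) {y : E3}
    (hy : y ∈ closure (polytope (I.cells.Hp i))) (hgen : I.Generic p y) (hpn : p.1 ≠ rc.rn r) :
    ∃ w ∈ polytope (I.cells.Hp i), ((⌊μ.rheight r y / hB⌋ : ℤ) : ℝ) * hB < μ.rheight r w ∧
      μ.rheight r w < (((⌊μ.rheight r y / hB⌋ : ℤ) : ℝ) + 1) * hB := by
  set h₀ := μ.rheight r y with hh₀
  obtain ⟨h1, h2⟩ := Mesh₅.floor_slab h₀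
  obtain ⟨w, hw, hlt, hlt'⟩ := I.exists_mem_inner_gt hp hy hgen (rc.hrn r) hpn
    (η := (((⌊h₀ / hB⌋ : ℤ) : ℝ) + 1) * hB - h₀) (by linarith)
  have ey := μ.rheight_eq r y
  have ew := μ.rheight_eq r w
  refine ⟨w, hw, ?_, ?_⟩ <;> linarith

/-- **LEMMA SH AT A GENERIC CONTACT**: column grains on both sides, the slab `⌊rheight y / hB⌋` with shared boundary layers, a non-horizontal datum:
the class lattices agree. -/
theorem lattice_eq_of_shared_contact (r : Fin rc.nr) {i i' : Fin I.cells.M} (hne : i ≠ i') (hgi : I.grain i = rc.rtL r ∨ I.grain i = rc.rtR r)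
    (hgi' : I.grain i' = rc.rtL r ∨ I.grain i' = rc.rtR r) {p : E3 × ℝ} (hp : p ∈ I.cells.Hp i) {y : E3} (hy : y ∈ I.contact i i' p)
    (hgen : I.Generic p y) (hs0 : μ.IsSharedLayer r ⌊μ.rheight r y / hB⌋) (hs1 : μ.IsSharedLayer r (⌊μ.rheight r y / hB⌋ + 1))
    (hp1 : p.1 ≠ rc.rn r) (hp2 : p.1 ≠ -rc.rn r) :
    (rc.tent (I.grain i)).frame (I.slab i) '' fccRef = (rc.tent (I.grain i')).frame (I.slab i') '' fccRef := by
  obtain ⟨w, hw, hwm⟩ := I.exists_mem_rslab r hp hy.1.1 hgen hp1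
  have hp' : antip p ∈ I.cells.Hp i' := I.antip_mem_Hp_of_contact hne hp hy hgen
  have hpn' : (antip p).1 ≠ rc.rn r := by
    intro h
    apply hp2
    simp only [antip] at h
    rw [← h, neg_neg]
  obtain ⟨w', hw', hw'm⟩ := I.exists_mem_rslab r hp' hy.2 (I.generic_antip hgen) hpn'
  exact I.lattice_eq_of_shared_slab r hgi hgi' hs0 hs1 hw hwm hw' hw'm

end TexInput

end Summit.Ventures.Crystal3D.Cruxes.TextureLiminf.TexShadow

end
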